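import Mathlib
import Summits.ResolutionOfSingularities.ResolutionOfSingularities.Theorems.RadicialJungCleanModelsCleanLU3CompositeCurveStep
import Summits.ResolutionOfSingularities.ResolutionOfSingularities.Theorems.RadicialJungCleanModelsCleanLU3ArcPackage
import HarnessLib

/-!
# Route `RadicialJung`, crux `CleanModels` (stmt-15917), stub `stub_cleanLU3DefectNonDiscrete`, sub-line (C): LIFTING loose clean form (1)
# from the residue surface by blowing up curves (glue G3/G3′ of the lead's brief `Lines/Sketch-brief-Cdiv-subline.md`, completed)

Line `Sketch` rev 24 of crux stmt-ResolutionOfSingularities-15917; lead `res-B-lead-1` g3.  OURS; nothing here proves resolution in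
characteristic `p`.  Setting of the composite sub-line: `A ⊆ A₁ ⊆ O` finitely generated models over `k` with every centre a closed point
(`hzd`), `R₁ = locAtCentre A₁ O` regular of dimension 3 with regular system of parameters `(t, t₂, t₃)` where `t` is INFINITELY DEEPER than
the monomials in `t₂, t₃` (`v t < v (t₂^a t₃^b)` for all `a, b` — e.g. `t ∈ 𝔪_{O₁}`, `t₂, t₃ ∈ O₁^×` for a coarsening `O₁`).  Then:

* `exists_model_rsop_div_pow` — for every `n`, a finitely generated model `A₂ ⊇ A` along `O` whose local ring `R₂ ⊇ R₁` is regular of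
  dimension 3 with regular system of parameters `(t / t₂^n, t₂, t₃)` (iterate ✓ `curveChart_step`; models by ✓ `exists_model_of_isLocalBlowup`,
  dimension by ✓ `ringKrullDim_locAtCentre_eq_of_isMaximal`).
* `exists_model_rsop_div_monomial` — the same with `t / (t₂^a t₃^b)`.
* `formOne_lift` — if `g = u · t₂^a t₃^b + t · w` with `u, w ∈ R₁`, `v u = 1` (form (1) on the surface `{t = 0}` with an error term divisible by
  `t`), then on such a model `g = t₂^a t₃^b · u″` with `u″` a unit of `R₂` and `(t/(t₂^a t₃^b), t₂, t₃)` a regular system of parameters of `R₂`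
  — loose clean form (1) upstairs (exponents divisible by `p` are then absorbed into the representative by the consumer).
-/

noncomputable section

set_option linter.dupNamespace false -- mandated namespace of this single-conjunct summit

open IsLocalRing
open Literature.AlgebraicGeometry.Resolution

namespace Summit.ResolutionOfSingularities.ResolutionOfSingularities.Theorems.RadicialJung.CleanModels

variable {K : Type} [Field K] {k : Type} [Field k] [Algebra k K]

/-- `(maximalIdeal R).spanFinrank = 3` for a regular local ring of dimension 3. [folklore] -/
theorem spanFinrank_eq_three_of_dim (R : Subring K) [hR : IsRegularLocalRing R] (hdim : ringKrullDim R = 3) :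
    (maximalIdeal R).spanFinrank = 3 := by
  have h := hR.spanFinrank_maximalIdeal
  rw [hdim] at h
  exact_mod_cast h

/-- **Iterated blow-up of the curve `{t = t₂ = 0}` along `O`, with finitely generated models**: see the module docstring. [folklore] -/
theorem exists_model_rsop_div_pow (O : ValuationSubring K) (A : Subalgebra k K) (hAfg : A.FG) [IsFractionRing A K]
    (hzd : ∀ (T : Subring K) (hT : T ≤ O.toSubring), A.toSubring ≤ T → (subringCentre T O hT).IsMaximal)
    (hdimA : ringKrullDim A = 3) :
    ∀ (n : ℕ) (A₁ : Subalgebra k K) (_ : A ≤ A₁) (_ : A₁.FG) (hA₁O : A₁.toSubring ≤ O.toSubring)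
      (_ : IsRegularLocalRing (locAtCentre A₁.toSubring O))
      (t t₂ t₃ : K) (ht : t ∈ locAtCentre A₁.toSubring O) (ht₂ : t₂ ∈ locAtCentre A₁.toSubring O)
      (ht₃ : t₃ ∈ locAtCentre A₁.toSubring O),
      (haveI := isLocalRing_locAtCentre hA₁O; maximalIdeal (locAtCentre A₁.toSubring O)) =
        Ideal.span {⟨t, ht⟩, ⟨t₂, ht₂⟩, ⟨t₃, ht₃⟩} →
      (∀ m : ℕ, O.valuation t < O.valuation (t₂ ^ (m + 1))) →
      ∃ (A₂ : Subalgebra k K), A ≤ A₂ ∧ A₂.FG ∧ ∃ (hA₂O : A₂.toSubring ≤ O.toSubring),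
        IsRegularLocalRing (locAtCentre A₂.toSubring O) ∧ locAtCentre A₁.toSubring O ≤ locAtCentre A₂.toSubring O ∧
        ∃ (h₁ : t / t₂ ^ n ∈ locAtCentre A₂.toSubring O) (h₂ : t₂ ∈ locAtCentre A₂.toSubring O)
          (h₃ : t₃ ∈ locAtCentre A₂.toSubring O),
          (haveI := isLocalRing_locAtCentre hA₂O; maximalIdeal (locAtCentre A₂.toSubring O)) =
            Ideal.span {⟨_, h₁⟩, ⟨_, h₂⟩, ⟨_, h₃⟩} := by
  intro n
  induction n with
  | zero =>
    intro A₁ hAA₁ hA₁fg hA₁O hreg₁ t t₂ t₃ ht ht₂ ht₃ hmax _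
    refine ⟨A₁, hAA₁, hA₁fg, hA₁O, hreg₁, le_rfl, ?_, ht₂, ht₃, ?_⟩
    · rw [pow_zero, div_one]; exact ht
    · refine hmax.trans ?_
      congr 2
      apply Subtype.ext
      change t = t / t₂ ^ 0
      rw [pow_zero, div_one]
  | succ n ih =>
    intro A₁ hAA₁ hA₁fg hA₁O hreg₁ t t₂ t₃ ht ht₂ ht₃ hmax hdeep
    -- `n` steps first
    obtain ⟨A₂, hAA₂, hA₂fg, hA₂O, hreg₂, h12, h₁, h₂, h₃, hmax₂⟩ :=
      ih A₁ hAA₁ hA₁fg hA₁O hreg₁ t t₂ t₃ ht ht₂ ht₃ hmax hdeep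
    -- one more step with `t' = t / t₂^n`
    set R₂ := locAtCentre A₂.toSubring O with hR₂
    haveI := hreg₂
    have hdimA₂ : ringKrullDim (locAtCentre A₂.toSubring O) = 3 := by
      rw [ringKrullDim_locAtCentre_eq_of_isMaximal A₂ hA₂fg O hA₂O (hzd _ hA₂O (fun z hz => hAA₂ hz)),
        ringKrullDim_eq_of_fg_of_le hAfg hA₂fg hAA₂, hdimA]
    have hd : (maximalIdeal R₂).spanFinrank = 3 := spanFinrank_eq_three_of_dim R₂ hdimA₂
    have hR₂O : R₂ ≤ O.toSubring := locAtCentre_le hA₂O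
    have hdom₂ : SubringDominates R₂ O.toSubring := subringDominates_locAtCentre hA₂O
    have ht₂0 : t₂ ≠ 0 := by
      intro h0; have := hdeep 0; rw [h0, zero_pow (by norm_num), map_zero] at this; exact not_lt.mpr zero_le this
    have hv : O.valuation ((⟨t / t₂ ^ n, h₁⟩ : R₂) : K) < O.valuation ((⟨t₂, h₂⟩ : R₂) : K) := by
      change O.valuation (t / t₂ ^ n) < O.valuation t₂
      rw [map_div₀, map_pow, div_lt_iff₀ (pow_pos (zero_lt_iff.mpr ((Valuation.ne_zero_iff _).mpr ht₂0)) n), ← pow_succ',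
        ← map_pow]
      exact hdeep n
    have hspan : Ideal.span {(⟨t / t₂ ^ n, h₁⟩ : R₂), ⟨t₂, h₂⟩, ⟨t₃, h₃⟩} = maximalIdeal R₂ := hmax₂.symm
    obtain ⟨R', hR'eq, h2R', hR'O, hreg', -, g₁, g₂, g₃, hmax'⟩ :=
      curveChart_step O R₂ hR₂O hdom₂ hd ⟨_, h₁⟩ ⟨_, h₂⟩ ⟨_, h₃⟩ hspan hv
    -- `R'` is a local blow-up of `R₂`, hence the local ring of a finitely generated model
    have hlb : IsLocalBlowup O R₂ R' := by
      refine ⟨hR₂O, {t / t₂ ^ n / t₂}, ?_, ?_⟩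
      · intro z hz
        rw [Finset.coe_singleton, Set.mem_singleton_iff] at hz
        rw [hz]
        exact hR'O g₁
      · rw [Finset.coe_singleton]; exact hR'eq
    obtain ⟨A₃, hA₃O, hAA₃, hA₃fg, hR'A₃⟩ := exists_model_of_isLocalBlowup hAA₂ hA₂fg hlb
    subst hR'A₃
    refine ⟨A₃, hAA₃, hA₃fg, hA₃O, hreg', h12.trans h2R', ?_, g₂, g₃, ?_⟩
    · have : t / t₂ ^ (n + 1) = t / t₂ ^ n / t₂ := by rw [pow_succ, div_div]
      rw [this]; exact g₁
    · refine hmax'.trans ?_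
      congr 2
      apply Subtype.ext
      change t / t₂ ^ n / t₂ = t / t₂ ^ (n + 1)
      rw [pow_succ, div_div]

/-- **Extended version of `exists_model_rsop_div_pow`** returning `A₁ ≤ A₂` alongside `A ≤ A₂`.
Iterated blow-up of the curve `{t = t₂ = 0}` along `O`, with finitely generated models, AND the input model `A₁`
is contained in the output model `A₂`. [folklore] -/
theorem exists_model_rsop_div_pow_with_input_le (O : ValuationSubring K) (A : Subalgebra k K) (hAfg : A.FG) [IsFractionRing A K]
    (hzd : ∀ (T : Subring K) (hT : T ≤ O.toSubring), A.toSubring ≤ T → (subringCentre T O hT).IsMaximal)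
    (hdimA : ringKrullDim A = 3) :
    ∀ (n : ℕ) (A₁ : Subalgebra k K) (_ : A ≤ A₁) (_ : A₁.FG) (hA₁O : A₁.toSubring ≤ O.toSubring)
      (_ : IsRegularLocalRing (locAtCentre A₁.toSubring O))
      (t t₂ t₃ : K) (ht : t ∈ locAtCentre A₁.toSubring O) (ht₂ : t₂ ∈ locAtCentre A₁.toSubring O)
      (ht₃ : t₃ ∈ locAtCentre A₁.toSubring O),
      (haveI := isLocalRing_locAtCentre hA₁O; maximalIdeal (locAtCentre A₁.toSubring O)) =
        Ideal.span {⟨t, ht⟩, ⟨t₂, ht₂⟩, ⟨t₃, ht₃⟩} →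
      (∀ m : ℕ, O.valuation t < O.valuation (t₂ ^ (m + 1))) →
      ∃ (A₂ : Subalgebra k K), A ≤ A₂ ∧ A₁ ≤ A₂ ∧ A₂.FG ∧ ∃ (hA₂O : A₂.toSubring ≤ O.toSubring),
        IsRegularLocalRing (locAtCentre A₂.toSubring O) ∧ locAtCentre A₁.toSubring O ≤ locAtCentre A₂.toSubring O ∧
        ∃ (h₁ : t / t₂ ^ n ∈ locAtCentre A₂.toSubring O) (h₂ : t₂ ∈ locAtCentre A₂.toSubring O)
          (h₃ : t₃ ∈ locAtCentre A₂.toSubring O),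
          (haveI := isLocalRing_locAtCentre hA₂O; maximalIdeal (locAtCentre A₂.toSubring O)) =
            Ideal.span {⟨_, h₁⟩, ⟨_, h₂⟩, ⟨_, h₃⟩} := by
  intro n
  induction n with
  | zero =>
    intro A₁ hAA₁ hA₁fg hA₁O hreg₁ t t₂ t₃ ht ht₂ ht₃ hmax _
    refine ⟨A₁, hAA₁, le_rfl, hA₁fg, hA₁O, hreg₁, le_rfl, ?_, ht₂, ht₃, ?_⟩
    · rw [pow_zero, div_one]; exact ht
    · refine hmax.trans ?_
      congr 2
      apply Subtype.ext
      change t = t / t₂ ^ 0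
      rw [pow_zero, div_one]
  | succ n ih =>
    intro A₁ hAA₁ hA₁fg hA₁O hreg₁ t t₂ t₃ ht ht₂ ht₃ hmax hdeep
    -- `n` steps first
    obtain ⟨A₂, hAA₂, hA₁A₂, hA₂fg, hA₂O, hreg₂, h12, h₁, h₂, h₃, hmax₂⟩ :=
      ih A₁ hAA₁ hA₁fg hA₁O hreg₁ t t₂ t₃ ht ht₂ ht₃ hmax hdeep
    -- one more step with `t' = t / t₂^n`
    set R₂ := locAtCentre A₂.toSubring O with hR₂
    haveI := hreg₂
    have hdimA₂ : ringKrullDim (locAtCentre A₂.toSubring O) = 3 := by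
      rw [ringKrullDim_locAtCentre_eq_of_isMaximal A₂ hA₂fg O hA₂O (hzd _ hA₂O (fun z hz => hAA₂ hz)),
        ringKrullDim_eq_of_fg_of_le hAfg hA₂fg hAA₂, hdimA]
    have hd : (maximalIdeal R₂).spanFinrank = 3 := spanFinrank_eq_three_of_dim R₂ hdimA₂
    have hR₂O : R₂ ≤ O.toSubring := locAtCentre_le hA₂O
    have hdom₂ : SubringDominates R₂ O.toSubring := subringDominates_locAtCentre hA₂O
    have ht₂0 : t₂ ≠ 0 := by
      intro h0; have := hdeep 0; rw [h0, zero_pow (by norm_num), map_zero] at this; exact not_lt.mpr zero_le this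
    have hv : O.valuation ((⟨t / t₂ ^ n, h₁⟩ : R₂) : K) < O.valuation ((⟨t₂, h₂⟩ : R₂) : K) := by
      change O.valuation (t / t₂ ^ n) < O.valuation t₂
      rw [map_div₀, map_pow, div_lt_iff₀ (pow_pos (zero_lt_iff.mpr ((Valuation.ne_zero_iff _).mpr ht₂0)) n), ← pow_succ',
        ← map_pow]
      exact hdeep n
    have hspan : Ideal.span {(⟨t / t₂ ^ n, h₁⟩ : R₂), ⟨t₂, h₂⟩, ⟨t₃, h₃⟩} = maximalIdeal R₂ := hmax₂.symm
    obtain ⟨R', hR'eq, h2R', hR'O, hreg', -, g₁, g₂, g₃, hmax'⟩ :=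
      curveChart_step O R₂ hR₂O hdom₂ hd ⟨_, h₁⟩ ⟨_, h₂⟩ ⟨_, h₃⟩ hspan hv
    -- `R'` is a local blow-up of `R₂`, hence the local ring of a finitely generated model
    have hlb : IsLocalBlowup O R₂ R' := by
      refine ⟨hR₂O, {t / t₂ ^ n / t₂}, ?_, ?_⟩
      · intro z hz
        rw [Finset.coe_singleton, Set.mem_singleton_iff] at hz
        rw [hz]
        exact hR'O g₁
      · rw [Finset.coe_singleton]; exact hR'eq
    obtain ⟨A₃, hA₃O, hAA₃, hA₂A₃, hA₃fg, hR'A₃⟩ := exists_model_of_isLocalBlowup_with_input_le hAA₂ hA₂fg hlb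
    subst hR'A₃
    refine ⟨A₃, hAA₃, hA₁A₂.trans hA₂A₃, hA₃fg, hA₃O, hreg', h12.trans h2R', ?_, g₂, g₃, ?_⟩
    · have : t / t₂ ^ (n + 1) = t / t₂ ^ n / t₂ := by rw [pow_succ, div_div]
      rw [this]; exact g₁
    · refine hmax'.trans ?_
      congr 2
      apply Subtype.ext
      change t / t₂ ^ n / t₂ = t / t₂ ^ (n + 1)
      rw [pow_succ, div_div]

/-- Reordering a three-element generating set. [folklore] -/
theorem span_triple_swap {S : Type} [CommRing S] (a b c : S) : Ideal.span ({a, b, c} : Set S) = Ideal.span {a, c, b} := by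
  rw [Set.pair_comm b c]

/-- **Iterated blow-ups of the curves `{t = t₂ = 0}` and `{t = t₃ = 0}`**: a finitely generated model along `O` whose local ring is regular (of
dimension 3) with regular system of parameters `(t / (t₂^a t₃^b), t₂, t₃)`, when `t` is infinitely deeper than the monomials in `t₂, t₃`. [folklore] -/
theorem exists_model_rsop_div_monomial (O : ValuationSubring K) (A : Subalgebra k K) (hAfg : A.FG) [IsFractionRing A K]
    (hzd : ∀ (T : Subring K) (hT : T ≤ O.toSubring), A.toSubring ≤ T → (subringCentre T O hT).IsMaximal)
    (hdimA : ringKrullDim A = 3) (A₁ : Subalgebra k K) (hAA₁ : A ≤ A₁) (hA₁fg : A₁.FG) (hA₁O : A₁.toSubring ≤ O.toSubring)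
    (hreg₁ : IsRegularLocalRing (locAtCentre A₁.toSubring O))
    (t t₂ t₃ : K) (ht : t ∈ locAtCentre A₁.toSubring O) (ht₂ : t₂ ∈ locAtCentre A₁.toSubring O)
    (ht₃ : t₃ ∈ locAtCentre A₁.toSubring O)
    (hmax : (haveI := isLocalRing_locAtCentre hA₁O; maximalIdeal (locAtCentre A₁.toSubring O)) =
      Ideal.span {⟨t, ht⟩, ⟨t₂, ht₂⟩, ⟨t₃, ht₃⟩})
    (hdeep : ∀ a b : ℕ, O.valuation t < O.valuation (t₂ ^ a * t₃ ^ b)) (a b : ℕ) :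
    ∃ (A₂ : Subalgebra k K), A ≤ A₂ ∧ A₂.FG ∧ ∃ (hA₂O : A₂.toSubring ≤ O.toSubring),
      IsRegularLocalRing (locAtCentre A₂.toSubring O) ∧ locAtCentre A₁.toSubring O ≤ locAtCentre A₂.toSubring O ∧
      ∃ (h₁ : t / (t₂ ^ a * t₃ ^ b) ∈ locAtCentre A₂.toSubring O) (h₂ : t₂ ∈ locAtCentre A₂.toSubring O)
        (h₃ : t₃ ∈ locAtCentre A₂.toSubring O),
        (haveI := isLocalRing_locAtCentre hA₂O; maximalIdeal (locAtCentre A₂.toSubring O)) =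
          Ideal.span {⟨_, h₁⟩, ⟨_, h₂⟩, ⟨_, h₃⟩} := by
  have ht₂0 : t₂ ≠ 0 := by
    intro h0; have := hdeep 1 0; rw [h0, pow_one, zero_mul, map_zero] at this; exact not_lt.mpr zero_le this
  have ht₃0 : t₃ ≠ 0 := by
    intro h0; have := hdeep 0 1; rw [h0, pow_one, mul_zero, map_zero] at this; exact not_lt.mpr zero_le this
  -- `a` steps along `t₂`
  have hdeep₂ : ∀ m : ℕ, O.valuation t < O.valuation (t₂ ^ (m + 1)) := fun m => by
    have := hdeep (m + 1) 0; rwa [pow_zero, mul_one] at this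
  obtain ⟨A₂, hAA₂, hA₂fg, hA₂O, hreg₂, h12, h₁, h₂, h₃, hmax₂⟩ :=
    exists_model_rsop_div_pow O A hAfg hzd hdimA a A₁ hAA₁ hA₁fg hA₁O hreg₁ t t₂ t₃ ht ht₂ ht₃ hmax hdeep₂
  -- `b` steps along `t₃`, with the roles of `t₂, t₃` swapped
  have hmax₂' : (haveI := isLocalRing_locAtCentre hA₂O; maximalIdeal (locAtCentre A₂.toSubring O)) =
      Ideal.span {⟨_, h₁⟩, ⟨_, h₃⟩, ⟨_, h₂⟩} := hmax₂.trans (span_triple_swap _ _ _)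
  have hdeep₃ : ∀ m : ℕ, O.valuation (t / t₂ ^ a) < O.valuation (t₃ ^ (m + 1)) := fun m => by
    have hpos : 0 < O.valuation (t₂ ^ a) := by
      rw [map_pow]; exact pow_pos (zero_lt_iff.mpr ((Valuation.ne_zero_iff _).mpr ht₂0)) a
    rw [map_div₀, div_lt_iff₀ hpos, ← map_mul, mul_comm]
    exact hdeep a (m + 1)
  obtain ⟨A₃, hAA₃, hA₃fg, hA₃O, hreg₃, h23, g₁, g₃, g₂, hmax₃⟩ :=
    exists_model_rsop_div_pow O A hAfg hzd hdimA b A₂ hAA₂ hA₂fg hA₂O hreg₂ (t / t₂ ^ a) t₃ t₂ h₁ h₃ h₂ hmax₂' hdeep₃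
  refine ⟨A₃, hAA₃, hA₃fg, hA₃O, hreg₃, h12.trans h23, ?_, g₂, g₃, ?_⟩
  · rw [← div_div]; exact g₁
  · refine (hmax₃.trans (span_triple_swap _ _ _)).trans ?_
    congr 2
    apply Subtype.ext
    change t / t₂ ^ a / t₃ ^ b = t / (t₂ ^ a * t₃ ^ b)
    rw [div_div]

/-- **Loose clean form (1) lifts from the surface `{t = 0}`**: in the setting of `exists_model_rsop_div_monomial`, if `g = u · (t₂^a t₃^b) + t · w`
with `u, w ∈ R₁ = locAtCentre A₁ O` and `v u = 1`, then on some finitely generated model `A₂ ⊇ A` along `O` with regular local ring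
`R₂ ⊇ R₁` (of dimension 3, regular system of parameters `(t/(t₂^a t₃^b), t₂, t₃)`), `g = u″ · (t₂^a t₃^b)` with `u″` a UNIT of `R₂`.
[folklore] -/
theorem formOne_lift (O : ValuationSubring K) (A : Subalgebra k K) (hAfg : A.FG) [IsFractionRing A K]
    (hzd : ∀ (T : Subring K) (hT : T ≤ O.toSubring), A.toSubring ≤ T → (subringCentre T O hT).IsMaximal)
    (hdimA : ringKrullDim A = 3) (A₁ : Subalgebra k K) (hAA₁ : A ≤ A₁) (hA₁fg : A₁.FG) (hA₁O : A₁.toSubring ≤ O.toSubring)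
    (hreg₁ : IsRegularLocalRing (locAtCentre A₁.toSubring O))
    (t t₂ t₃ : K) (ht : t ∈ locAtCentre A₁.toSubring O) (ht₂ : t₂ ∈ locAtCentre A₁.toSubring O)
    (ht₃ : t₃ ∈ locAtCentre A₁.toSubring O)
    (hmax : (haveI := isLocalRing_locAtCentre hA₁O; maximalIdeal (locAtCentre A₁.toSubring O)) =
      Ideal.span {⟨t, ht⟩, ⟨t₂, ht₂⟩, ⟨t₃, ht₃⟩})
    (hdeep : ∀ a b : ℕ, O.valuation t < O.valuation (t₂ ^ a * t₃ ^ b)) (a b : ℕ)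
    (g u w : K) (hu : u ∈ locAtCentre A₁.toSubring O) (hvu : O.valuation u = 1) (hw : w ∈ locAtCentre A₁.toSubring O)
    (hg : g = u * (t₂ ^ a * t₃ ^ b) + t * w) :
    ∃ (A₂ : Subalgebra k K), A ≤ A₂ ∧ A₂.FG ∧ ∃ (hA₂O : A₂.toSubring ≤ O.toSubring),
      IsRegularLocalRing (locAtCentre A₂.toSubring O) ∧ locAtCentre A₁.toSubring O ≤ locAtCentre A₂.toSubring O ∧
      ringKrullDim (locAtCentre A₂.toSubring O) = 3 ∧
      ∃ (h₁ : t / (t₂ ^ a * t₃ ^ b) ∈ locAtCentre A₂.toSubring O) (h₂ : t₂ ∈ locAtCentre A₂.toSubring O)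
        (h₃ : t₃ ∈ locAtCentre A₂.toSubring O) (u'' : locAtCentre A₂.toSubring O),
        (haveI := isLocalRing_locAtCentre hA₂O; maximalIdeal (locAtCentre A₂.toSubring O)) =
          Ideal.span {⟨_, h₁⟩, ⟨_, h₂⟩, ⟨_, h₃⟩} ∧ IsUnit u'' ∧ g = (u'' : K) * (t₂ ^ a * t₃ ^ b) := by
  obtain ⟨A₂, hAA₂, hA₂fg, hA₂O, hreg₂, h12, h₁, h₂, h₃, hmax₂⟩ :=
    exists_model_rsop_div_monomial O A hAfg hzd hdimA A₁ hAA₁ hA₁fg hA₁O hreg₁ t t₂ t₃ ht ht₂ ht₃ hmax hdeep a b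
  haveI := hreg₂
  have hdim₂ : ringKrullDim (locAtCentre A₂.toSubring O) = 3 := by
    rw [ringKrullDim_locAtCentre_eq_of_isMaximal A₂ hA₂fg O hA₂O (hzd _ hA₂O (fun z hz => hAA₂ hz)),
      ringKrullDim_eq_of_fg_of_le hAfg hA₂fg hAA₂, hdimA]
  have hM0 : t₂ ^ a * t₃ ^ b ≠ 0 := by
    intro h0; have := hdeep a b; rw [h0, map_zero] at this; exact not_lt.mpr zero_le this
  -- the unit `u'' = u + (t / M) w`
  set t'' : K := t / (t₂ ^ a * t₃ ^ b) with ht''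
  have hu''mem : u + t'' * w ∈ locAtCentre A₂.toSubring O :=
    Subring.add_mem _ (h12 hu) (Subring.mul_mem _ h₁ (h12 hw))
  have hvt'' : O.valuation t'' < 1 := by
    have hpos : 0 < O.valuation (t₂ ^ a * t₃ ^ b) := zero_lt_iff.mpr ((Valuation.ne_zero_iff _).mpr hM0)
    rw [ht'', map_div₀, div_lt_one₀ hpos]; exact hdeep a b
  have hvw : O.valuation w ≤ 1 := (O.valuation_le_one_iff _).mpr (locAtCentre_le hA₁O hw)
  have hvtw : O.valuation (t'' * w) < O.valuation u := by
    rw [hvu, map_mul]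
    calc O.valuation t'' * O.valuation w ≤ O.valuation t'' * 1 := by gcongr
      _ < 1 := by rw [mul_one]; exact hvt''
  have hvu'' : O.valuation (u + t'' * w) = 1 := by rw [Valuation.map_add_eq_of_lt_left _ hvtw, hvu]
  have hunit : IsUnit (⟨u + t'' * w, hu''mem⟩ : locAtCentre A₂.toSubring O) := by
    by_contra hnu
    have hmem : (⟨u + t'' * w, hu''mem⟩ : locAtCentre A₂.toSubring O) ∈ maximalIdeal _ :=
      (IsLocalRing.mem_maximalIdeal _).mpr hnu
    have := (mem_maximalIdeal_locAtCentre_iff hA₂O _).mp hmem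
    change O.valuation (u + t'' * w) < 1 at this
    rw [hvu''] at this
    exact lt_irrefl _ this
  refine ⟨A₂, hAA₂, hA₂fg, hA₂O, hreg₂, h12, hdim₂, h₁, h₂, h₃, ⟨u + t'' * w, hu''mem⟩, hmax₂, hunit, ?_⟩
  change g = (u + t'' * w) * (t₂ ^ a * t₃ ^ b)
  have hcalc : t'' * w * (t₂ ^ a * t₃ ^ b) = t * w := by
    rw [ht'', mul_right_comm, div_mul_cancel₀ _ hM0]
  rw [add_mul, hcalc, hg]

end Summit.ResolutionOfSingularities.ResolutionOfSingularities.Theorems.RadicialJung.CleanModels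

end
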